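import Mathlib.Algebra.MvPolynomial.Basic
import Mathlib.Algebra.Order.AbsoluteValue.Basic
import Mathlib.Algebra.Order.Ring.IsNonarchimedean
import Mathlib.Data.Finsupp.MonomialOrder
import Mathlib.Algebra.Order.Archimedean.Real.Basic
import Mathlib.Order.ConditionallyCompleteLattice.Finset
import Mathlib.Data.Fintype.Card
import HarnessLib

/-!
# Roy's small value estimate for `𝔾ₐ × 𝔾ₘ` — Gauss's lemma for the coefficient norm of a product at a non-archimedean place

Topic `Literature/NumberTheory/Transcendental`. Part of the formalisation of the proof of Roy 2013,
Theorem 1.1 (named fact `roy2013_thm_1_1`, `RoySmallValueEstimates.lean`), seat B (an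
elimination-free reorganisation of §§2, 5–6 of D. Roy, *A small value estimate for `𝔾ₐ × 𝔾ₘ`*,
Mathematika 59 (2013) 333–363 = arXiv:1301.0663). Roy's Propositions 2.2 (ii) and 6.4 bound the
HEIGHTS of the zero-dimensional cycles cut out by integer forms (via Laurent–Roy 2001, §§4–5).
In this development those bounds are obtained from a Gelfond–Mahler inequality for products of
linear forms, whose non-archimedean half is Gauss's lemma for the sup norm of the coefficients of
a multivariate polynomial at a non-archimedean absolute value `v` of a field `K`:

* `iSup_coeff_mul_le` — `‖G₁ G₂‖_v ≤ ‖G₁‖_v ‖G₂‖_v` (ultrametric inequality);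
* `iSup_coeff_mul` — `‖G₁ G₂‖_v = ‖G₁‖_v ‖G₂‖_v` for variables indexed by a well-ordered type,
  e.g. `Fin N` (choose, in the lexicographic monomial order, the largest monomials of `G₁`, `G₂` among those of maximal absolute value; the
  corresponding coefficient of the product is dominated by a single term);
* `iSup_coeff_C_mul`, `iSup_coeff_pow`, `iSup_coeff_finset_prod`, `iSup_coeff_linearForm` — the
  consequences used for `a ∏ ℓ_j^{e_j}` with linear forms `ℓ_j`.

Here `‖G‖_v` is written `⨆ s : G.support, v (coeff s G)` (as in Mathlib's
`Mathlib.NumberTheory.Height.MvPolynomial`; it is `0` for `G = 0`). Everything is proved; no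
definitions, no named facts.

## References

* [Roy2013] D. Roy, *A small value estimate for 𝔾ₐ × 𝔾ₘ*, Mathematika 59 (2013), 333–363
  (arXiv:1301.0663), §2 (Prop. 2.2 (ii)), §6 (Prop. 6.4) — the height estimates this replaces.
-/

noncomputable section

open MvPolynomial Finset

namespace Literature.NumberTheory.Transcendental

namespace Roy2013

variable {K : Type*} [Field K] {ι : Type*}

/-! ### The coefficient norm `⨆ s : G.support, v (coeff s G)` -/

/-- The coefficient norm is non-negative. [folklore] -/
theorem iSup_coeff_nonneg (v : AbsoluteValue K ℝ) (G : MvPolynomial ι K) :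
    0 ≤ ⨆ s : G.support, v (coeff s G) :=
  Real.iSup_nonneg fun _ => v.nonneg _

/-- Each coefficient is bounded by the coefficient norm. [folklore] -/
theorem le_iSup_coeff (v : AbsoluteValue K ℝ) (G : MvPolynomial ι K) (t : ι →₀ ℕ) :
    v (coeff t G) ≤ ⨆ s : G.support, v (coeff s G) := by
  by_cases ht : t ∈ G.support
  · exact Finite.le_ciSup_of_le (⟨t, ht⟩ : G.support) le_rfl
  · rw [notMem_support_iff.mp ht, v.map_zero]
    exact iSup_coeff_nonneg v G

/-- The coefficient norm of a non-zero polynomial is attained. [folklore] -/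
theorem exists_eq_iSup_coeff (v : AbsoluteValue K ℝ) {G : MvPolynomial ι K} (hG : G ≠ 0) :
    ∃ s ∈ G.support, v (coeff s G) = ⨆ s : G.support, v (coeff s G) := by
  have hne : Nonempty G.support := (support_nonempty.mpr hG).to_subtype
  obtain ⟨s, hs⟩ := exists_eq_ciSup_of_finite (f := fun s : G.support => v (coeff s G))
  exact ⟨s, s.2, hs⟩

/-- The coefficient norm of a non-zero polynomial is positive. [folklore] -/
theorem iSup_coeff_pos (v : AbsoluteValue K ℝ) {G : MvPolynomial ι K} (hG : G ≠ 0) :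
    0 < ⨆ s : G.support, v (coeff s G) := by
  obtain ⟨s, hs, heq⟩ := exists_eq_iSup_coeff v hG
  rw [← heq]
  exact v.pos (mem_support_iff.mp hs)

/-- The coefficient norm of `0` is `0`. [folklore] -/
theorem iSup_coeff_zero (v : AbsoluteValue K ℝ) :
    (⨆ s : (0 : MvPolynomial ι K).support, v (coeff s (0 : MvPolynomial ι K))) = 0 := by
  have : IsEmpty (0 : MvPolynomial ι K).support := by
    rw [support_zero]; exact ⟨fun s => notMem_empty _ s.2⟩
  rw [Real.iSup_of_isEmpty]

/-- The norm of a monomial. [folklore] -/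
theorem iSup_coeff_monomial (v : AbsoluteValue K ℝ) (s : ι →₀ ℕ) (a : K) :
    (⨆ t : (monomial s a).support, v (coeff t (monomial s a))) = v a := by
  classical
  rcases eq_or_ne a 0 with rfl | ha
  · rw [monomial_zero, iSup_coeff_zero, v.map_zero]
  refine le_antisymm ?_ ?_
  · have hne : Nonempty (monomial s a).support :=
      ⟨⟨s, by rw [support_monomial, if_neg ha]; exact mem_singleton_self _⟩⟩
    refine ciSup_le fun t => ?_
    rw [coeff_monomial]
    split_ifs
    · exact le_rfl
    · rw [v.map_zero]; exact v.nonneg _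
  · simpa using le_iSup_coeff v (monomial s a) s

/-- The norm of a constant. [folklore] -/
theorem iSup_coeff_C (v : AbsoluteValue K ℝ) (a : K) :
    (⨆ t : (C a : MvPolynomial ι K).support, v (coeff (t : ι →₀ ℕ) (C a : MvPolynomial ι K))) =
      v a :=
  iSup_coeff_monomial v 0 a

/-! ### The ultrametric inequality for products -/

/-- **Gauss's lemma, easy half**: `‖G₁ G₂‖_v ≤ ‖G₁‖_v ‖G₂‖_v` at a non-archimedean `v`.
[folklore] -/
theorem iSup_coeff_mul_le {v : AbsoluteValue K ℝ} (hv : IsNonarchimedean v)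
    (G₁ G₂ : MvPolynomial ι K) :
    (⨆ s : (G₁ * G₂).support, v (coeff s (G₁ * G₂))) ≤
      (⨆ s : G₁.support, v (coeff s G₁)) * ⨆ s : G₂.support, v (coeff s G₂) := by
  classical
  have h0 : 0 ≤ (⨆ s : G₁.support, v (coeff s G₁)) * ⨆ s : G₂.support, v (coeff s G₂) :=
    mul_nonneg (iSup_coeff_nonneg v G₁) (iSup_coeff_nonneg v G₂)
  rcases isEmpty_or_nonempty (G₁ * G₂).support with h | h
  · rw [Real.iSup_of_isEmpty]; exact h0
  refine ciSup_le fun s => ?_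
  rw [coeff_mul]
  have hne : (antidiagonal (s : ι →₀ ℕ)).Nonempty := ⟨(0, s), mem_antidiagonal.mpr (zero_add _)⟩
  obtain ⟨p, -, hp⟩ := hv.finset_image_add_of_nonempty
    (fun p : (ι →₀ ℕ) × (ι →₀ ℕ) => coeff p.1 G₁ * coeff p.2 G₂) hne
  refine hp.trans ?_
  rw [v.map_mul]
  exact mul_le_mul (le_iSup_coeff v G₁ _) (le_iSup_coeff v G₂ _) (v.nonneg _)
    (iSup_coeff_nonneg v G₁)

/-! ### Gauss's lemma -/

/-- **Gauss's lemma** for the coefficient norm at a non-archimedean absolute value: for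
polynomials in finitely many variables over a field, `‖G₁ G₂‖_v = ‖G₁‖_v ‖G₂‖_v`. Proof: order the
monomials by a monomial order; among the monomials of `Gᵢ` whose coefficient has maximal
absolute value let `mᵢ` be the largest; in the coefficient `∑_{p+q = m₁+m₂} a_p b_q` of the product
every term other than `a_{m₁} b_{m₂}` has strictly smaller absolute value, so the sum has absolute
value `‖G₁‖_v ‖G₂‖_v`. [folklore] -/
theorem iSup_coeff_mul [LinearOrder ι] [WellFoundedGT ι] {v : AbsoluteValue K ℝ}
    (hv : IsNonarchimedean v) (G₁ G₂ : MvPolynomial ι K) :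
    (⨆ s : (G₁ * G₂).support, v (coeff s (G₁ * G₂))) =
      (⨆ s : G₁.support, v (coeff s G₁)) * ⨆ s : G₂.support, v (coeff s G₂) := by
  rcases eq_or_ne G₁ 0 with rfl | hG₁
  · rw [zero_mul, iSup_coeff_zero, zero_mul]
  rcases eq_or_ne G₂ 0 with rfl | hG₂
  · rw [mul_zero, iSup_coeff_zero, mul_zero]
  refine le_antisymm (iSup_coeff_mul_le hv G₁ G₂) ?_
  -- the lexicographic monomial order on `ι →₀ ℕ`
  let mo : MonomialOrder ι := MonomialOrder.lex
  haveI : ∀ (G : MvPolynomial ι K) (H : ℝ), DecidablePred fun s : ι →₀ ℕ => v (coeff s G) = H :=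
    fun G H => Classical.decPred _
  set H₁ := ⨆ s : G₁.support, v (coeff s G₁) with hH₁
  set H₂ := ⨆ s : G₂.support, v (coeff s G₂) with hH₂
  have hH₁pos : 0 < H₁ := iSup_coeff_pos v hG₁
  have hH₂pos : 0 < H₂ := iSup_coeff_pos v hG₂
  -- the largest monomials of maximal absolute value
  set S₁ := G₁.support.filter fun s => v (coeff s G₁) = H₁ with hS₁
  set S₂ := G₂.support.filter fun s => v (coeff s G₂) = H₂ with hS₂
  have hS₁ne : S₁.Nonempty := by
    obtain ⟨s, hs, heq⟩ := exists_eq_iSup_coeff v hG₁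
    exact ⟨s, mem_filter.mpr ⟨hs, heq⟩⟩
  have hS₂ne : S₂.Nonempty := by
    obtain ⟨s, hs, heq⟩ := exists_eq_iSup_coeff v hG₂
    exact ⟨s, mem_filter.mpr ⟨hs, heq⟩⟩
  obtain ⟨m₁, hm₁, hm₁max⟩ := S₁.exists_max_image (fun s => mo.toSyn s) hS₁ne
  obtain ⟨m₂, hm₂, hm₂max⟩ := S₂.exists_max_image (fun s => mo.toSyn s) hS₂ne
  have hvm₁ : v (coeff m₁ G₁) = H₁ := (mem_filter.mp hm₁).2
  have hvm₂ : v (coeff m₂ G₂) = H₂ := (mem_filter.mp hm₂).2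
  -- domination of the other terms of the coefficient of `m₁ + m₂`
  have hdom : ∀ p ∈ antidiagonal (m₁ + m₂), p ≠ (m₁, m₂) →
      v (coeff p.1 G₁ * coeff p.2 G₂) < v (coeff m₁ G₁ * coeff m₂ G₂) := by
    intro p hp hne
    rw [v.map_mul, v.map_mul, hvm₁, hvm₂]
    have h1 : v (coeff p.1 G₁) ≤ H₁ := le_iSup_coeff v G₁ _
    have h2 : v (coeff p.2 G₂) ≤ H₂ := le_iSup_coeff v G₂ _
    rcases h1.lt_or_eq with h1 | h1
    · calc v (coeff p.1 G₁) * v (coeff p.2 G₂) ≤ v (coeff p.1 G₁) * H₂ :=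
            mul_le_mul_of_nonneg_left h2 (v.nonneg _)
        _ < H₁ * H₂ := mul_lt_mul_of_pos_right h1 hH₂pos
    rcases h2.lt_or_eq with h2 | h2
    · calc v (coeff p.1 G₁) * v (coeff p.2 G₂) ≤ H₁ * v (coeff p.2 G₂) :=
            mul_le_mul_of_nonneg_right h1.le (v.nonneg _)
        _ < H₁ * H₂ := mul_lt_mul_of_pos_left h2 hH₁pos
    -- both maximal: then `p.1 ≼ m₁`, `p.2 ≼ m₂`, not both equal, contradicting `p.1 + p.2 = m₁ + m₂`
    exfalso
    have hp1 : p.1 ∈ S₁ := by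
      refine mem_filter.mpr ⟨mem_support_iff.mpr fun h0 => ?_, h1⟩
      rw [h0, v.map_zero] at h1; exact hH₁pos.ne' h1.symm
    have hp2 : p.2 ∈ S₂ := by
      refine mem_filter.mpr ⟨mem_support_iff.mpr fun h0 => ?_, h2⟩
      rw [h0, v.map_zero] at h2; exact hH₂pos.ne' h2.symm
    have hle1 : mo.toSyn p.1 ≤ mo.toSyn m₁ := hm₁max _ hp1
    have hle2 : mo.toSyn p.2 ≤ mo.toSyn m₂ := hm₂max _ hp2
    have hsum : mo.toSyn p.1 + mo.toSyn p.2 = mo.toSyn m₁ + mo.toSyn m₂ := by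
      rw [← map_add, ← map_add, mem_antidiagonal.mp hp]
    have hlt : mo.toSyn p.1 + mo.toSyn p.2 < mo.toSyn m₁ + mo.toSyn m₂ := by
      rcases hle1.lt_or_eq with hlt1 | heq1
      · exact add_lt_add_of_lt_of_le hlt1 hle2
      · have hp1eq : p.1 = m₁ := mo.toSyn.injective heq1
        have hp2ne : p.2 ≠ m₂ := fun h => hne (Prod.ext hp1eq h)
        have hlt2 : mo.toSyn p.2 < mo.toSyn m₂ :=
          hle2.lt_of_ne fun h => hp2ne (mo.toSyn.injective h)
        exact add_lt_add_of_le_of_lt hle1 hlt2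
    exact absurd hsum hlt.ne
  -- the coefficient of `m₁ + m₂` in the product
  have hcoeff : v (coeff (m₁ + m₂) (G₁ * G₂)) = H₁ * H₂ := by
    have hk : (m₁, m₂) ∈ antidiagonal (m₁ + m₂) := mem_antidiagonal.mpr rfl
    have key := hv.apply_sum_eq_of_lt (s := antidiagonal (m₁ + m₂)) (k := (m₁, m₂))
      (l := fun p : (ι →₀ ℕ) × (ι →₀ ℕ) => coeff p.1 G₁ * coeff p.2 G₂)
      (fun a => (v.map_neg a).symm) hk hdom
    rw [coeff_mul]
    exact key.trans (by rw [v.map_mul, hvm₁, hvm₂])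
  calc H₁ * H₂ = v (coeff (m₁ + m₂) (G₁ * G₂)) := hcoeff.symm
    _ ≤ _ := le_iSup_coeff v (G₁ * G₂) _

/-! ### Consequences -/

/-- `‖a G‖_v = |a|_v ‖G‖_v`. [folklore] -/
theorem iSup_coeff_C_mul [LinearOrder ι] [WellFoundedGT ι] {v : AbsoluteValue K ℝ} (hv : IsNonarchimedean v) (a : K)
    (G : MvPolynomial ι K) :
    (⨆ s : (C a * G).support, v (coeff s (C a * G))) = v a * ⨆ s : G.support, v (coeff s G) := by
  rw [iSup_coeff_mul hv, iSup_coeff_C]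

/-- `‖G^e‖_v = ‖G‖_v^e`. [folklore] -/
theorem iSup_coeff_pow [LinearOrder ι] [WellFoundedGT ι] {v : AbsoluteValue K ℝ} (hv : IsNonarchimedean v)
    (G : MvPolynomial ι K) (e : ℕ) :
    (⨆ s : (G ^ e).support, v (coeff s (G ^ e))) = (⨆ s : G.support, v (coeff s G)) ^ e := by
  induction e with
  | zero => rw [pow_zero, pow_zero, ← C_1, iSup_coeff_C, v.map_one]
  | succ e ih => rw [pow_succ, iSup_coeff_mul hv, ih, pow_succ]

/-- `‖∏ⱼ Gⱼ‖_v = ∏ⱼ ‖Gⱼ‖_v`. [folklore] -/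
theorem iSup_coeff_finset_prod [LinearOrder ι] [WellFoundedGT ι] {v : AbsoluteValue K ℝ} (hv : IsNonarchimedean v)
    {J : Type*} (s : Finset J) (G : J → MvPolynomial ι K) :
    (⨆ t : (∏ j ∈ s, G j).support, v (coeff t (∏ j ∈ s, G j))) =
      ∏ j ∈ s, ⨆ t : (G j).support, v (coeff t (G j)) := by
  classical
  induction s using Finset.induction with
  | empty => rw [prod_empty, prod_empty, ← C_1, iSup_coeff_C, v.map_one]
  | insert j s hj ih => rw [prod_insert hj, prod_insert hj, iSup_coeff_mul hv, ih]

/-- The coefficient norm of a linear form `∑ᵢ cᵢ Xᵢ` is `maxᵢ |cᵢ|_v`. [folklore] -/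
theorem iSup_coeff_linearForm [Fintype ι] (v : AbsoluteValue K ℝ) (c : ι → K) :
    (⨆ t : (∑ i, C (c i) * X i : MvPolynomial ι K).support,
        v (coeff t (∑ i, C (c i) * X i : MvPolynomial ι K))) = ⨆ i, v (c i) := by
  classical
  set L : MvPolynomial ι K := ∑ i, C (c i) * X i with hL
  have hcoeff : ∀ i, coeff (Finsupp.single i 1) L = c i := by
    intro i
    rw [hL, coeff_sum]
    simp_rw [C_mul_X_eq_monomial, coeff_monomial]
    rw [Finset.sum_eq_single i]
    · rw [if_pos rfl]
    · intro j _ hji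
      rw [if_neg]
      intro h
      exact hji (Finsupp.single_left_injective one_ne_zero h)
    · intro h; exact absurd (mem_univ i) h
  have hsupp : ∀ t ∈ L.support, ∃ i, t = Finsupp.single i 1 := by
    intro t ht
    rw [hL] at ht
    simp_rw [C_mul_X_eq_monomial] at ht
    obtain ⟨i, -, hi⟩ := mem_biUnion.mp (support_sum ht)
    rw [support_monomial] at hi
    split_ifs at hi with h
    · exact absurd hi (notMem_empty _)
    · exact ⟨i, mem_singleton.mp hi⟩
  refine le_antisymm ?_ ?_
  · rcases isEmpty_or_nonempty L.support with h | h
    · rw [Real.iSup_of_isEmpty]; exact Real.iSup_nonneg fun i => v.nonneg _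
    refine ciSup_le fun t => ?_
    obtain ⟨i, hi⟩ := hsupp t t.2
    rw [hi, hcoeff]
    exact Finite.le_ciSup_of_le i le_rfl
  · rcases isEmpty_or_nonempty ι with h | h
    · rw [Real.iSup_of_isEmpty]; exact iSup_coeff_nonneg v L
    refine ciSup_le fun i => ?_
    rw [← hcoeff i]
    exact le_iSup_coeff v L _

end Roy2013

end Literature.NumberTheory.Transcendental
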